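import Mathlib
import Summits.KontsevichZagierPeriods.Zeta5Search.SorokinCensus.GeneralizedMoves
import HarnessLib

/-!
HONEST FRAMING: systematic search; no irrationality claim unless certified.

# The generalized Sorokin family `J₅^gen` — Euler (FAMILY.md §17; = Fischler's `𝒥(p)`, C. R. Math. 335 (2002) §3)

This module: `EulerInvariance` PROVED (`eulerInvariance_holds`): the substitution `x₀ ↦ (1-x₀)/(1-x₀u₂)` as an involutive diffeomorphism `eulerMap` of the open cube, Jacobian `eulerDeriv`, `integral_image_eq_integral_abs_det_fderiv_smul`.

fam-sorokin gen 4 (planner-pub-zeta5-fam-sorokin-g4-0), staged `SorokinGeneralized.lean` v9 (sha256 e6bbed22…, 1570 l., filing request #2 FINAL-6 = last); split by the cell filing lane (lead/lit g11) at the gate's 400-line cap into `Generalized` (defs + statement nodes) → `GeneralizedSigma` → `GeneralizedMoves` → `GeneralizedEuler` → `GeneralizedReversalCoords` → `GeneralizedReversal` (linear import chain; mathematics verbatim, one-line docstrings added where missing, a private cube-measurability lemma duplicated across the split).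
Nothing here is an irrationality statement: elementary identities / calculus of absolutely convergent 5-fold integrals and integer bookkeeping.
-/

namespace Summit.KontsevichZagierPeriods.Zeta5Search.SorokinCensus

open Literature.NumberTheory.Irrationality.Zudilin2002 MeasureTheory Finset Set
open GenPoint

/-! ## The Euler identity `EulerInvariance` (ψ₁), PROVED by the change of variables `x₀ ↦ (1-x₀)/(1-x₀u₂)`

The substitution is an involutive diffeomorphism `eulerMap` of the OPEN cube (other coordinates fixed), with Jacobian
determinant `-(1-u₂)/(1-x₀u₂)²`; Mathlib's `integral_image_eq_integral_abs_det_fderiv_smul` and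
`integrableOn_image_iff_integrableOn_abs_det_fderiv_smul` transport the integral and integrability, and the pointwise
identity `|det| · p.integrand (eulerMap y) = (ψ₁ p).integrand y` on the open cube is Euler's computation with integer
exponents. The closed and open cubes differ by a null set. -/

/-- The open unit cube. -/
def ocube : Set (Fin 5 → ℝ) := Set.pi Set.univ fun _ : Fin 5 => Set.Ioo (0 : ℝ) 1

/-- `measurableSet_ocube`: `: MeasurableSet ocube`. -/
theorem measurableSet_ocube : MeasurableSet ocube := MeasurableSet.univ_pi fun _ => measurableSet_Ioo

/-- `ocube_ae_eq_cube`: `: ocube =ᵐ[(volume : Measure (Fin 5 → ℝ))] cube 5`. -/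
theorem ocube_ae_eq_cube : ocube =ᵐ[(volume : Measure (Fin 5 → ℝ))] cube 5 := by
  rw [volume_pi]
  exact Measure.pi_Ioo_ae_eq_pi_Icc

/-- `mem_ocube`: `{y : Fin 5 → ℝ} : y ∈ ocube ↔ ∀ j, 0 < y j ∧ y j < 1`. -/
theorem mem_ocube {y : Fin 5 → ℝ} : y ∈ ocube ↔ ∀ j, 0 < y j ∧ y j < 1 := by
  simp [ocube]

/-- `GenPoint.J_eq_ocube`: `(p : GenPoint) : p.J = ∫ x in ocube, p.integrand x`. -/
theorem GenPoint.J_eq_ocube (p : GenPoint) : p.J = ∫ x in ocube, p.integrand x :=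
  (setIntegral_congr_set ocube_ae_eq_cube).symm

/-- `GenPoint.integrable_iff_ocube`: `(p : GenPoint) : p.Integrable ↔ IntegrableOn p.integrand ocube`. -/
theorem GenPoint.integrable_iff_ocube (p : GenPoint) : p.Integrable ↔ IntegrableOn p.integrand ocube :=
  ⟨fun h => h.congr_set_ae ocube_ae_eq_cube, fun h => h.congr_set_ae ocube_ae_eq_cube.symm⟩

/-- `unit_step`: `{t v : ℝ} (ht : 0 < t ∧ t < 1) (hv : 0 < v ∧ v < 1) : 0 < 1 - t * v ∧ 1 - t * v < 1`. -/
theorem unit_step {t v : ℝ} (ht : 0 < t ∧ t < 1) (hv : 0 < v ∧ v < 1) : 0 < 1 - t * v ∧ 1 - t * v < 1 := by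
  have := mul_pos ht.1 hv.1
  constructor <;> nlinarith

/-- On the open cube the continued products `u₂, u₃, u₄` lie in `(0,1)`. -/
theorem tailQ_bounds {y : Fin 5 → ℝ} (hy : y ∈ ocube) :
    (0 < tailQ y 1 ∧ tailQ y 1 < 1) ∧ (0 < tailQ y 2 ∧ tailQ y 2 < 1) ∧ (0 < tailQ y 3 ∧ tailQ y 3 < 1) := by
  rw [mem_ocube] at hy
  have h4 : 0 < 1 - y 4 ∧ 1 - y 4 < 1 := by constructor <;> linarith [(hy 4).1, (hy 4).2]
  have h3 : 0 < 1 - y 3 * (1 - y 4) ∧ 1 - y 3 * (1 - y 4) < 1 := unit_step (hy 3) h4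
  have h2 : 0 < 1 - y 2 * (1 - y 3 * (1 - y 4)) ∧ 1 - y 2 * (1 - y 3 * (1 - y 4)) < 1 := unit_step (hy 2) h3
  have h1 := unit_step (hy 1) h2
  rw [tailQ_one_eq, tailQ_two_eq, tailQ_three_eq]
  exact ⟨h1, h2, h3⟩

/-- `tailQ_zero_eq'`: `(x : Fin 5 → ℝ) : tailQ x 0 = 1 - x 0 * tailQ x 1`. -/
theorem tailQ_zero_eq' (x : Fin 5 → ℝ) : tailQ x 0 = 1 - x 0 * tailQ x 1 := by
  rw [tailQ_zero_eq, tailQ_one_eq]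

/-- `one_sub_tailQ_one`: `(x : Fin 5 → ℝ) : 1 - tailQ x 1 = x 1 * tailQ x 2`. -/
theorem one_sub_tailQ_one (x : Fin 5 → ℝ) : 1 - tailQ x 1 = x 1 * tailQ x 2 := by
  rw [tailQ_one_eq, tailQ_two_eq]; ring

/-- Euler's substitution in the first coordinate: `x₀ ↦ (1-x₀)/(1-x₀u₂)`. -/
noncomputable def eulerPhi (x : Fin 5 → ℝ) : ℝ := (1 - x 0) / (1 - x 0 * tailQ x 1)

/-- The substitution as a self-map of `ℝ⁵` (coordinates `1..4` fixed). -/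
noncomputable def eulerMap (x : Fin 5 → ℝ) : Fin 5 → ℝ := Function.update x 0 (eulerPhi x)

/-- `eulerMap_apply_zero`: `(x : Fin 5 → ℝ) : eulerMap x 0 = eulerPhi x`. -/
@[simp] theorem eulerMap_apply_zero (x : Fin 5 → ℝ) : eulerMap x 0 = eulerPhi x := by simp [eulerMap]
/-- `eulerMap_apply_of_ne` (auxiliary lemma). -/
theorem eulerMap_apply_of_ne (x : Fin 5 → ℝ) {j : Fin 5} (hj : j ≠ 0) : eulerMap x j = x j := by simp [eulerMap, hj]
/-- `eulerMap_apply_one`: `(x : Fin 5 → ℝ) : eulerMap x 1 = x 1`. -/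
@[simp] theorem eulerMap_apply_one (x : Fin 5 → ℝ) : eulerMap x 1 = x 1 := eulerMap_apply_of_ne x (by decide)
/-- `eulerMap_apply_two` (simp lemma). -/
@[simp] theorem eulerMap_apply_two (x : Fin 5 → ℝ) : eulerMap x 2 = x 2 := eulerMap_apply_of_ne x (by decide)
/-- `eulerMap_apply_three` (simp lemma). -/
@[simp] theorem eulerMap_apply_three (x : Fin 5 → ℝ) : eulerMap x 3 = x 3 := eulerMap_apply_of_ne x (by decide)
/-- `eulerMap_apply_four` (simp lemma). -/
@[simp] theorem eulerMap_apply_four (x : Fin 5 → ℝ) : eulerMap x 4 = x 4 := eulerMap_apply_of_ne x (by decide)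

/-- `tailQ_eulerMap_one`: `(x : Fin 5 → ℝ) : tailQ (eulerMap x) 1 = tailQ x 1`. -/
@[simp] theorem tailQ_eulerMap_one (x : Fin 5 → ℝ) : tailQ (eulerMap x) 1 = tailQ x 1 := by
  rw [tailQ_one_eq, tailQ_one_eq]; simp
/-- `tailQ_eulerMap_two`: `(x : Fin 5 → ℝ) : tailQ (eulerMap x) 2 = tailQ x 2`. -/
@[simp] theorem tailQ_eulerMap_two (x : Fin 5 → ℝ) : tailQ (eulerMap x) 2 = tailQ x 2 := by
  rw [tailQ_two_eq, tailQ_two_eq]; simp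
/-- `tailQ_eulerMap_three`: `(x : Fin 5 → ℝ) : tailQ (eulerMap x) 3 = tailQ x 3`. -/
@[simp] theorem tailQ_eulerMap_three (x : Fin 5 → ℝ) : tailQ (eulerMap x) 3 = tailQ x 3 := by
  rw [tailQ_three_eq, tailQ_three_eq]; simp

/-- `eulerDen_pos`: `{y : Fin 5 → ℝ} (hy : y ∈ ocube) : 0 < 1 - y 0 * tailQ y 1`. -/
theorem eulerDen_pos {y : Fin 5 → ℝ} (hy : y ∈ ocube) : 0 < 1 - y 0 * tailQ y 1 := by
  have hU := (tailQ_bounds hy).1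
  have h0 := (mem_ocube.mp hy) 0
  nlinarith [mul_lt_mul'' h0.2 hU.2 h0.1.le hU.1.le]

/-- `one_sub_eulerPhi`: `{y : Fin 5 → ℝ} (hD : 1 - y 0 * tailQ y 1 ≠ 0) : 1 - eulerPhi y = y 0 * (1 - tailQ y 1) / (1 - y 0 * tailQ …`. -/
theorem one_sub_eulerPhi {y : Fin 5 → ℝ} (hD : 1 - y 0 * tailQ y 1 ≠ 0) :
    1 - eulerPhi y = y 0 * (1 - tailQ y 1) / (1 - y 0 * tailQ y 1) := by
  unfold eulerPhi
  field_simp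
  ring

/-- `one_sub_eulerPhi_mul`: `{y : Fin 5 → ℝ} (hD : 1 - y 0 * tailQ y 1 ≠ 0) : 1 - eulerPhi y * tailQ y 1 = (1 - tailQ y 1) / (1 - y 0 * …`. -/
theorem one_sub_eulerPhi_mul {y : Fin 5 → ℝ} (hD : 1 - y 0 * tailQ y 1 ≠ 0) :
    1 - eulerPhi y * tailQ y 1 = (1 - tailQ y 1) / (1 - y 0 * tailQ y 1) := by
  unfold eulerPhi
  field_simp
  ring

/-- `tailQ_eulerMap_zero`: `{y : Fin 5 → ℝ} (hD : 1 - y 0 * tailQ y 1 ≠ 0) : tailQ (eulerMap y) 0 = (1 - tailQ y 1) / (1 - y 0 * tailQ …`. -/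
theorem tailQ_eulerMap_zero {y : Fin 5 → ℝ} (hD : 1 - y 0 * tailQ y 1 ≠ 0) :
    tailQ (eulerMap y) 0 = (1 - tailQ y 1) / (1 - y 0 * tailQ y 1) := by
  rw [tailQ_zero_eq', tailQ_eulerMap_one, eulerMap_apply_zero, one_sub_eulerPhi_mul hD]

/-- `eulerMap_mem`: `{y : Fin 5 → ℝ} (hy : y ∈ ocube) : eulerMap y ∈ ocube`. -/
theorem eulerMap_mem {y : Fin 5 → ℝ} (hy : y ∈ ocube) : eulerMap y ∈ ocube := by
  have hD := eulerDen_pos hy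
  have hU := (tailQ_bounds hy).1
  have hy' := mem_ocube.mp hy
  rw [mem_ocube]
  intro j
  by_cases hj : j = 0
  · subst hj
    rw [eulerMap_apply_zero, eulerPhi]
    refine ⟨div_pos (by linarith [(hy' 0).2]) hD, ?_⟩
    rw [div_lt_one hD]
    nlinarith [(hy' 0).1, hU.2]
  · rw [eulerMap_apply_of_ne _ hj]; exact hy' j

/-- `eulerMap_eulerMap`: `{y : Fin 5 → ℝ} (hy : y ∈ ocube) : eulerMap (eulerMap y) = y`. -/
theorem eulerMap_eulerMap {y : Fin 5 → ℝ} (hy : y ∈ ocube) : eulerMap (eulerMap y) = y := by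
  have hD := (eulerDen_pos hy).ne'
  have hU : 1 - tailQ y 1 ≠ 0 := (sub_pos.mpr (tailQ_bounds hy).1.2).ne'
  have hy0 : y 0 ≠ 0 := ((mem_ocube.mp hy) 0).1.ne'
  funext j
  by_cases hj : j = 0
  · subst hj
    rw [eulerMap_apply_zero]
    unfold eulerPhi
    rw [tailQ_eulerMap_one, eulerMap_apply_zero, one_sub_eulerPhi hD, one_sub_eulerPhi_mul hD]
    field_simp
  · rw [eulerMap_apply_of_ne _ hj, eulerMap_apply_of_ne _ hj]

/-- `eulerMap_injOn`: `: Set.InjOn eulerMap ocube`. -/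
theorem eulerMap_injOn : Set.InjOn eulerMap ocube := by
  intro x hx y hy h
  rw [← eulerMap_eulerMap hx, ← eulerMap_eulerMap hy, h]

/-- `eulerMap_image`: `: eulerMap '' ocube = ocube`. -/
theorem eulerMap_image : eulerMap '' ocube = ocube := by
  refine Set.Subset.antisymm ?_ ?_
  · rintro _ ⟨y, hy, rfl⟩; exact eulerMap_mem hy
  · intro y hy; exact ⟨eulerMap y, eulerMap_mem hy, eulerMap_eulerMap hy⟩

/-- `differentiableAt_eulerPhi`: `{y : Fin 5 → ℝ} (hD : 1 - y 0 * tailQ y 1 ≠ 0) : DifferentiableAt ℝ eulerPhi y`. -/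
theorem differentiableAt_eulerPhi {y : Fin 5 → ℝ} (hD : 1 - y 0 * tailQ y 1 ≠ 0) : DifferentiableAt ℝ eulerPhi y := by
  have h : eulerPhi = fun x : Fin 5 → ℝ =>
      (1 - x 0) / (1 - x 0 * (1 - x 1 * (1 - x 2 * (1 - x 3 * (1 - x 4))))) := by
    funext x; simp [eulerPhi, tailQ_one_eq]
  rw [h]
  rw [tailQ_one_eq] at hD
  fun_prop (disch := exact hD)

/-- The derivative of `eulerMap`: identity in rows `1..4`, the gradient of `eulerPhi` in row `0`. -/
noncomputable def eulerDeriv (y : Fin 5 → ℝ) : (Fin 5 → ℝ) →L[ℝ] (Fin 5 → ℝ) :=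
  ContinuousLinearMap.pi fun i : Fin 5 => if i = 0 then fderiv ℝ eulerPhi y else ContinuousLinearMap.proj i

/-- `hasFDerivAt_eulerMap`: `{y : Fin 5 → ℝ} (hD : 1 - y 0 * tailQ y 1 ≠ 0) : HasFDerivAt eulerMap (eulerDeriv y) y`. -/
theorem hasFDerivAt_eulerMap {y : Fin 5 → ℝ} (hD : 1 - y 0 * tailQ y 1 ≠ 0) :
    HasFDerivAt eulerMap (eulerDeriv y) y := by
  show HasFDerivAt (fun x i => (fun (i : Fin 5) (x : Fin 5 → ℝ) => eulerMap x i) i x)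
    (ContinuousLinearMap.pi fun i : Fin 5 => if i = 0 then fderiv ℝ eulerPhi y else ContinuousLinearMap.proj i) y
  refine hasFDerivAt_pi.2 fun i => ?_
  by_cases hi : i = 0
  · subst hi
    simpa using (differentiableAt_eulerPhi hD).hasFDerivAt
  · simp only [eulerMap, Function.update_of_ne hi, if_neg hi]
    exact hasFDerivAt_apply i y

/-- `det (eulerDeriv y) = ∂₀ eulerPhi (y)` (the matrix is upper triangular with diagonal `(∂₀φ, 1, 1, 1, 1)`). -/
theorem det_eulerDeriv (y : Fin 5 → ℝ) : (eulerDeriv y).det = fderiv ℝ eulerPhi y (Pi.single 0 1) := by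
  show LinearMap.det ((eulerDeriv y : (Fin 5 → ℝ) →L[ℝ] (Fin 5 → ℝ)) : (Fin 5 → ℝ) →ₗ[ℝ] (Fin 5 → ℝ)) = _
  rw [← LinearMap.det_toMatrix']
  have hM : ∀ i j, LinearMap.toMatrix' ((eulerDeriv y : _ →L[ℝ] _) : (Fin 5 → ℝ) →ₗ[ℝ] (Fin 5 → ℝ)) i j =
      if i = 0 then fderiv ℝ eulerPhi y (Pi.single j 1) else if i = j then 1 else 0 := by
    intro i j
    rw [LinearMap.toMatrix'_apply, ContinuousLinearMap.coe_coe]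
    by_cases hi : i = 0
    · subst hi; simp [eulerDeriv]
    · simp [eulerDeriv, hi, Pi.single_apply]
  rw [Matrix.det_of_upperTriangular]
  · rw [Fin.prod_univ_succ]; simp [hM]
  · intro i j hij
    have hij' : j < i := hij
    have hi : i ≠ 0 := by
      rintro rfl
      exact absurd hij' (by simp)
    rw [hM]; simp [hi, ne_of_gt hij']

/-- The value of `∂₀ eulerPhi`: `-(1-u₂)/(1-x₀u₂)²`. -/
theorem fderiv_eulerPhi_single {y : Fin 5 → ℝ} (hD : 1 - y 0 * tailQ y 1 ≠ 0) :
    fderiv ℝ eulerPhi y (Pi.single 0 1) = -(1 - tailQ y 1) / (1 - y 0 * tailQ y 1) ^ 2 := by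
  have hl : HasFDerivAt eulerPhi (fderiv ℝ eulerPhi y) (Function.update y 0 (y 0)) := by
    rw [Function.update_eq_self]; exact (differentiableAt_eulerPhi hD).hasFDerivAt
  have hcomp := hl.comp_hasDerivAt (y 0) (hasDerivAt_update y 0 (y 0))
  have hfun : eulerPhi ∘ Function.update y 0 = fun t => (1 - t) / (1 - t * tailQ y 1) := by
    funext t
    simp [Function.comp, eulerPhi, tailQ_one_eq]
  rw [hfun] at hcomp
  have h1 : HasDerivAt (fun t => 1 - t) (-1) (y 0) := by simpa using (hasDerivAt_id (y 0)).const_sub 1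
  have h2 : HasDerivAt (fun t => 1 - t * tailQ y 1) (-(tailQ y 1)) (y 0) := by
    simpa using ((hasDerivAt_id (y 0)).mul_const (tailQ y 1)).const_sub 1
  have hexp := h1.div h2 hD
  rw [hcomp.unique hexp]
  ring

/-- `|det|` of the substitution on the open cube. -/
theorem abs_det_eulerDeriv {y : Fin 5 → ℝ} (hy : y ∈ ocube) :
    |(eulerDeriv y).det| = (1 - tailQ y 1) / (1 - y 0 * tailQ y 1) ^ 2 := by
  have hD := eulerDen_pos hy
  have hU := sub_pos.mpr (tailQ_bounds hy).1.2
  rw [det_eulerDeriv, fderiv_eulerPhi_single hD.ne', neg_div, abs_neg, abs_of_pos (div_pos hU (pow_pos hD 2))]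

namespace GenPoint

/-- `psi1_a`: `(p : GenPoint) (j : Fin 5) : p.psi1.a j = if j = 0 then p.c 0 else if j = 1 then p.a 1 + p.c 0 - p.a₀ else …`. -/
@[simp] theorem psi1_a (p : GenPoint) (j : Fin 5) :
    p.psi1.a j = if j = 0 then p.c 0 else if j = 1 then p.a 1 + p.c 0 - p.a₀ else p.a j := rfl
/-- `psi1_b`: `(p : GenPoint) (j : Fin 5) : p.psi1.b j = if j = 1 then p.b 1 + p.c 0 - p.a₀ else p.b j`. -/
@[simp] theorem psi1_b (p : GenPoint) (j : Fin 5) :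
    p.psi1.b j = if j = 1 then p.b 1 + p.c 0 - p.a₀ else p.b j := rfl
/-- `psi1_e`: `(p : GenPoint) (j : Fin 5) : p.psi1.e j = if j = 2 then p.e 2 + p.a₀ - p.c 0 else p.e j`. -/
@[simp] theorem psi1_e (p : GenPoint) (j : Fin 5) :
    p.psi1.e j = if j = 2 then p.e 2 + p.a₀ - p.c 0 else p.e j := rfl
/-- `psi1_a₀`: `(p : GenPoint) : p.psi1.a₀ = p.b 0 - p.a₀`. -/
@[simp] theorem psi1_a₀ (p : GenPoint) : p.psi1.a₀ = p.b 0 - p.a₀ := rfl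

/-- Euler's computation: the pointwise identity of integrands on the open cube. -/
theorem integrand_eulerMap (p : GenPoint) {y : Fin 5 → ℝ} (hy : y ∈ ocube) :
    |(eulerDeriv y).det| * p.integrand (eulerMap y) = p.psi1.integrand y := by
  have hDpos := eulerDen_pos hy
  have hD := hDpos.ne'
  obtain ⟨hU, hT2, _⟩ := tailQ_bounds hy
  have hy' := mem_ocube.mp hy
  have hy0 : y 0 ≠ 0 := (hy' 0).1.ne'
  have hy0' : 1 - y 0 ≠ 0 := (sub_pos.mpr (hy' 0).2).ne'
  have hy1 : y 1 ≠ 0 := (hy' 1).1.ne'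
  have hT2' : tailQ y 2 ≠ 0 := hT2.1.ne'
  rw [abs_det_eulerDeriv hy]
  unfold integrand
  simp only [Fin.prod_univ_five, eulerMap_apply_zero, eulerMap_apply_one, eulerMap_apply_two, eulerMap_apply_three,
    eulerMap_apply_four, tailQ_eulerMap_one, tailQ_eulerMap_two, tailQ_eulerMap_three, tailQ_eulerMap_zero hD,
    one_sub_eulerPhi hD, psi1_a, psi1_b, psi1_e, psi1_a₀, GenPoint.c, Fin.isValue]
  simp only [show (1 : Fin 5) = 0 ↔ False by decide, show (2 : Fin 5) = 0 ↔ False by decide,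
    show (3 : Fin 5) = 0 ↔ False by decide, show (4 : Fin 5) = 0 ↔ False by decide,
    show (0 : Fin 5) = 1 ↔ False by decide, show (2 : Fin 5) = 1 ↔ False by decide,
    show (3 : Fin 5) = 1 ↔ False by decide, show (4 : Fin 5) = 1 ↔ False by decide,
    show (1 : Fin 5) = 2 ↔ False by decide, show (3 : Fin 5) = 2 ↔ False by decide,
    if_true, if_false]
  rw [tailQ_zero_eq' y, one_sub_tailQ_one y]
  unfold eulerPhi
  rw [show p.b 0 - (p.b 0 - p.a 0) - 1 = p.a 0 - 1 by ring,
    show p.b 1 + (p.b 0 - p.a 0) - p.a₀ - (p.a 1 + (p.b 0 - p.a 0) - p.a₀) - 1 = p.b 1 - p.a 1 - 1 by ring]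
  -- exponent bookkeeping
  have e1 : y 1 ^ (p.a 1 + (p.b 0 - p.a 0) - p.a₀ - 1)
      = y 1 ^ (p.a 1 - 1) * y 1 ^ (p.b 0 - p.a 0 - 1) * y 1 * (y 1 ^ p.a₀)⁻¹ := by
    rw [show p.a 1 + (p.b 0 - p.a 0) - p.a₀ - 1 = (p.a 1 - 1) + (p.b 0 - p.a 0 - 1) + 1 - p.a₀ by ring,
      zpow_sub₀ hy1, zpow_add₀ hy1, zpow_add₀ hy1, zpow_one, div_eq_mul_inv]
  have e2 : tailQ y 2 ^ (-(p.e 2 + p.a₀ - (p.b 0 - p.a 0)))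
      = tailQ y 2 ^ (-p.e 2) * tailQ y 2 ^ (p.b 0 - p.a 0 - 1) * tailQ y 2 * (tailQ y 2 ^ p.a₀)⁻¹ := by
    rw [show -(p.e 2 + p.a₀ - (p.b 0 - p.a 0)) = (-p.e 2) + (p.b 0 - p.a 0 - 1) + 1 - p.a₀ by ring,
      zpow_sub₀ hT2', zpow_add₀ hT2', zpow_add₀ hT2', zpow_one, div_eq_mul_inv]
  have e3 : (1 - y 0 * tailQ y 1) ^ (-(p.b 0 - p.a₀))
      = ((1 - y 0 * tailQ y 1) ^ (p.a 0 - 1))⁻¹ * ((1 - y 0 * tailQ y 1) ^ (p.b 0 - p.a 0 - 1))⁻¹ *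
        ((1 - y 0 * tailQ y 1) ^ 2)⁻¹ * (1 - y 0 * tailQ y 1) ^ p.a₀ := by
    rw [show -(p.b 0 - p.a₀) = p.a₀ - (p.a 0 - 1) - (p.b 0 - p.a 0 - 1) - 2 by ring,
      zpow_sub₀ hD, zpow_sub₀ hD, zpow_sub₀ hD]
    rw [show ((1 - y 0 * tailQ y 1) ^ (2 : ℤ)) = (1 - y 0 * tailQ y 1) ^ (2 : ℕ) from zpow_ofNat _ 2]
    field_simp
  rw [e1, e2, e3]
  simp only [div_zpow, mul_zpow, zpow_neg, inv_div]
  ring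

end GenPoint

/-- **`EulerInvariance` holds**: `J(p) = J(ψ₁ p)` and integrability corresponds, for every parameter point. -/
theorem eulerInvariance_holds : EulerInvariance := by
  intro p
  have hderiv : ∀ y ∈ ocube, HasFDerivWithinAt eulerMap (eulerDeriv y) ocube y :=
    fun y hy => (hasFDerivAt_eulerMap (eulerDen_pos hy).ne').hasFDerivWithinAt
  have hpt : Set.EqOn (fun y => |(eulerDeriv y).det| • p.integrand (eulerMap y)) p.psi1.integrand ocube :=
    fun y hy => by simp only [smul_eq_mul]; exact p.integrand_eulerMap hy
  have hI := integral_image_eq_integral_abs_det_fderiv_smul volume measurableSet_ocube hderiv eulerMap_injOn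
    p.integrand
  rw [eulerMap_image] at hI
  have hInt := integrableOn_image_iff_integrableOn_abs_det_fderiv_smul volume measurableSet_ocube hderiv
    eulerMap_injOn p.integrand
  rw [eulerMap_image] at hInt
  refine ⟨?_, ?_⟩
  · rw [p.J_eq_ocube, p.psi1.J_eq_ocube, hI]
    exact setIntegral_congr_fun measurableSet_ocube hpt
  · rw [p.integrable_iff_ocube, p.psi1.integrable_iff_ocube, hInt]
    exact integrableOn_congr_fun hpt measurableSet_ocube

/-- With `EulerInvariance` proved, the balanced decomposition needs only the reversal identity. -/
theorem balancedDecompositionIntegrable_of_reversal (hR : ReversalInvariance) : BalancedDecompositionIntegrable :=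
  balancedDecompositionIntegrable_of eulerInvariance_holds hR

/-- The landed v2 node `EulerIdentity` (with its unused hypotheses) follows from `EulerInvariance`. -/
theorem eulerIdentity_holds : EulerIdentity := fun p _ _ _ => (eulerInvariance_holds p).1

end Summit.KontsevichZagierPeriods.Zeta5Search.SorokinCensus
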